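import Summits.QuantumFields.YangMills.Theorems.LuscherReductionTwistedTraceScalingRecordAnalytic
import HarnessLib

/-!
# The FROZEN FIBRE PROFILE OF RECORD `Ω_β = e^{−‖P_Γx‖²/δg²}·e^{−q_β(x)}·𝟙{‖x‖ ≤ r β}` and the structural fields `hΩm hΩ1 hΩinv hΩr hγ` of `RecordAnalyticInput`;
# the transverse measure charges every ball (`orthoTransverse_ball_pos`)
# (lane A of S-BASE, crux `TwistedTraceScaling` stmt-QuantumFields-20203, C4-CORE; design note `pub/ym-fleet/ym-luscher-20007-p1/COARSE-DESIGN.md` §24.2, §25.4)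

`RecordAnalyticInput L s M` (p652422) asks for a fibre profile family `Ω : ℝ → LinkSpace L → ℝ` with `hΩm` (measurable), `hΩ1` (`|Ω| ≤ 1`), `hΩinv` (colour blind), `hΩr` (supported in
`{‖x‖ ≤ r β}`) and `hγ` (`recordGamma L Ω β > 0` for EVERY `β`).  This file constructs the family of record and discharges these five fields for it:
* §1 ★ `orthoTransverse_ball_pos` — `π{v | ‖linkEmbed v‖ < ρ} > 0` for every `ρ > 0` (the open set `{U | ∀e, (U_e)₀ > 1 − δ}` of the torus lies in the orthographic tube with transverse
  coordinate of norm `≤ √(10δ|E|)` — `mem_orthoTubeSet_of_near_one` — and the a-priori measure charges open sets);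
* §2 ★ `recordGamma_pos_of_ball` — `recordGamma L Ω β > 0` as soon as `Ω β` is bounded measurable, supported in a ball, and non-vanishing on a smaller ball;
* §3 `frozenProfile L q r β x = exp(−‖P_Γ x‖²/(powScale 1 β)²)·exp(−q β x)·𝟙{‖x‖ ≤ r β}` for ANY measurable colour-blind `q β ≥ 0` (the stiff form; (B-T) holds for every member, (B-ST) will
  fix `q` as the stiff Mehler/Riccati ground form) and any radii `r β > 0`: ★★ `frozenProfile_fields` — `hΩm ∧ hΩ1 ∧ hΩinv ∧ hΩr ∧ hγ` (colour blindness from `starProjection_adL` and the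
  isometry `adL`).
HONEST FRAMING: construction of the data of the hand-off object; the analytic bricks (B-T)/(B-ST)/(B-OD) are OPEN; C4-CORE OPEN; stub of a child of the CONDITIONAL route R2b1; not infinite
volume, not a gap, not Clay.
-/

set_option autoImplicit false

noncomputable section

open MeasureTheory Filter Topology Real
open scoped BigOperators
open Literature.MathematicalPhysics.QuantumFieldTheory
open Literature.MathematicalPhysics.QuantumLattice

namespace Summit.QuantumFields.YangMills.Theorems.FemtoTransferGap.TwoLattice.ConstTube

open Summit.QuantumFields.YangMills.Theorems.FemtoTransferGap
open Summit.QuantumFields.YangMills.Theorems.FemtoTransferGap.TwoLattice.Avg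
open Summit.QuantumFields.YangMills.Theorems.FemtoTransferGap.TwoLattice.SlowChart
open Summit.QuantumFields.YangMills.Theorems.FemtoTransferGap.TwoLattice.Stiff (LinkSpace)

variable (L : ℕ) [NeZero L]

/-! ## §1 The transverse measure charges every ball -/

/-- `‖linkEmbed v‖² = Σ_e Σ_a (v e a)²`. [folklore] -/
theorem norm_linkEmbed_sq (v : Edge 3 L → Fin 3 → ℝ) : ‖linkEmbed L v‖ ^ 2 = ∑ e : Edge 3 L, ∑ a : Fin 3, v e a ^ 2 := by
  rw [EuclideanSpace.norm_sq_eq, Fintype.sum_prod_type]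
  simp only [linkEmbed_apply, Real.norm_eq_abs, sq_abs]

/-- The transverse measure of a measurable set is the a-priori measure of the corresponding part of the tube. [folklore] -/
theorem orthoTransverse_apply {A : Set (Edge 3 L → Fin 3 → ℝ)} (hA : MeasurableSet A) :
    orthoTransverse L A = configMeasure SU2 L (slowEmb (orthoChart L) '' (Set.univ ×ˢ (Subtype.val ⁻¹' A))) := by
  haveI : PolishSpace (capBalancedSet L) := (isClosed_capBalancedSet L).polishSpace
  unfold orthoTransverse
  rw [Measure.map_apply measurable_subtype_coe hA, slowMarginal_apply _ (measurable_subtype_coe hA),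
    slowMeasure_apply (continuous_orthoChart L) (orthoChart_injective L)]

/-- ★ **`π{‖linkEmbed v‖ < ρ} > 0`** for every `ρ > 0`. [folklore] -/
theorem orthoTransverse_ball_pos {ρ : ℝ} (hρ : 0 < ρ) : 0 < orthoTransverse L {v | ‖linkEmbed L v‖ < ρ} := by
  haveI : PolishSpace (capBalancedSet L) := (isClosed_capBalancedSet L).polishSpace
  haveI := configMeasure_isOpenPosMeasure (G := SU2) L
  have hA : MeasurableSet {v : Edge 3 L → Fin 3 → ℝ | ‖linkEmbed L v‖ < ρ} :=
    measurableSet_lt ((measurable_linkEmbed L).norm) measurable_const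
  rw [orthoTransverse_apply L hA]
  -- the width `δ` of the near-vacuum open set
  have hE : (0 : ℝ) < Fintype.card (Edge 3 L) := by exact_mod_cast Fintype.card_pos
  set δ : ℝ := min (1 / 50) (ρ ^ 2 / (20 * Fintype.card (Edge 3 L))) with hδ
  have hδ0 : 0 < δ := lt_min (by norm_num) (by positivity)
  have hδ50 : δ ≤ 1 / 50 := min_le_left _ _
  have hδρ : δ ≤ ρ ^ 2 / (20 * Fintype.card (Edge 3 L)) := min_le_right _ _
  set O : Set (GaugeConfig 3 L SU2) := {U | ∀ e : Edge 3 L, 1 - δ < scalarPart (U e)} with hO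
  have hOopen : IsOpen O := by
    have h : O = ⋂ e : Edge 3 L, {U : GaugeConfig 3 L SU2 | 1 - δ < scalarPart (U e)} := by ext U; simp [hO]
    rw [h]
    exact isOpen_iInter_of_finite fun e => isOpen_lt continuous_const (continuous_scalarPart.comp (continuous_apply e))
  have hO1 : (1 : GaugeConfig 3 L SU2) ∈ O := fun e => by
    show 1 - δ < scalarPart ((1 : GaugeConfig 3 L SU2) e)
    rw [Pi.one_apply, PolyakovLift.scalarPart_one]; linarith
  have hsub : O ⊆ slowEmb (orthoChart L) '' (Set.univ ×ˢ (Subtype.val ⁻¹' {v : Edge 3 L → Fin 3 → ℝ | ‖linkEmbed L v‖ < ρ})) := by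
    intro U hU
    obtain ⟨hUeq, -, hcap, hsq⟩ := mem_orthoTubeSet_of_near_one (L := L) hδ0.le hδ50 (fun e => (hU e).le)
    set v : Edge 3 L → Fin 3 → ℝ := fun e => vecPart (U e * (polarMean L e.2 U)⁻¹) with hv
    have hnorm : ‖linkEmbed L v‖ < ρ := by
      have h2 : ‖linkEmbed L v‖ ^ 2 < ρ ^ 2 := by
        rw [norm_linkEmbed_sq]
        calc ∑ e : Edge 3 L, ∑ a : Fin 3, v e a ^ 2 ≤ ∑ _e : Edge 3 L, 10 * δ := Finset.sum_le_sum fun e _ => hsq e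
          _ = Fintype.card (Edge 3 L) * (10 * δ) := by rw [Finset.sum_const, Finset.card_univ, nsmul_eq_mul]
          _ ≤ Fintype.card (Edge 3 L) * (10 * (ρ ^ 2 / (20 * Fintype.card (Edge 3 L)))) := by gcongr
          _ = ρ ^ 2 / 2 := by field_simp; ring
          _ < ρ ^ 2 := by nlinarith [sq_pos_of_pos hρ]
      exact (abs_lt_of_sq_lt_sq' h2 hρ.le).2
    refine ⟨((slowMean L U)⁻¹, ⟨v, hcap⟩), ⟨Set.mem_univ _, ?_⟩, ?_⟩
    · show ‖linkEmbed L v‖ < ρ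
      exact hnorm
    · show orthoChart L ((slowMean L U)⁻¹)⁻¹ ⟨v, hcap⟩ = U
      rw [inv_inv]
      exact hUeq
  exact lt_of_lt_of_le (hOopen.measure_pos _ ⟨1, hO1⟩) (measure_mono hsub)

/-! ## §2 `recordGamma > 0` from a non-vanishing ball -/

variable {L}

/-- ★ **`recordGamma L Ω β > 0`** whenever `Ω β` is measurable, bounded, supported in `{‖x‖ ≤ R}` and non-vanishing on a ball `{‖x‖ < ρ}`, `ρ > 0`. [folklore] -/
theorem recordGamma_pos_of_ball {Ω : ℝ → LinkSpace L → ℝ} {β : ℝ} (hΩm : Measurable (Ω β)) {CΩ : ℝ} (hCΩ : ∀ x, |Ω β x| ≤ CΩ) {R : ℝ} (hR : ∀ x, Ω β x ≠ 0 → ‖x‖ ≤ R)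
    {ρ : ℝ} (hρ : 0 < ρ) (hpos : ∀ x, ‖x‖ < ρ → Ω β x ≠ 0) : 0 < recordGamma L Ω β := by
  haveI := isFiniteMeasure_orthoTransverse L
  have hCΩ0 : 0 ≤ CΩ := (abs_nonneg _).trans (hCΩ 0)
  unfold recordGamma boGamma
  refine mul_pos (fpWeightBar_pos L (powScale_pos 1 β)) ?_
  set s : ℝ := powScale 1 β with hs
  have hs0 : 0 < s := powScale_pos 1 β
  set f : (Edge 3 L → Fin 3 → ℝ) → ℝ := fun v => Ω β (linkEmbed L v) ^ 2 * Real.exp (‖(gaugeModes L).starProjection (linkEmbed L v)‖ ^ 2 / s ^ 2) with hf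
  have hfm : Measurable f := by
    rw [hf]
    exact ((hΩm.comp (measurable_linkEmbed L)).pow_const 2).mul
      (Real.measurable_exp.comp ((((gaugeModes L).starProjection.continuous.measurable.comp (measurable_linkEmbed L)).norm.pow_const 2).div_const _))
  have hf0 : ∀ v, 0 ≤ f v := fun v => mul_nonneg (sq_nonneg _) (Real.exp_pos _).le
  -- boundedness (the exponential factor is bounded on the support of `Ω`)
  have hfb : ∀ v, |f v| ≤ CΩ ^ 2 * Real.exp (R ^ 2 / s ^ 2) := fun v => by
    rw [abs_of_nonneg (hf0 v), hf]; dsimp only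
    by_cases hz : Ω β (linkEmbed L v) = 0
    · rw [hz]; simp only [ne_eq, OfNat.ofNat_ne_zero, not_false_eq_true, zero_pow, zero_mul]; positivity
    · have hx : ‖linkEmbed L v‖ ≤ R := hR _ hz
      have h1 : Ω β (linkEmbed L v) ^ 2 ≤ CΩ ^ 2 := by
        rw [← sq_abs]; exact pow_le_pow_left₀ (abs_nonneg _) (hCΩ _) 2
      have h2 : ‖(gaugeModes L).starProjection (linkEmbed L v)‖ ^ 2 / s ^ 2 ≤ R ^ 2 / s ^ 2 := by
        have hP : ‖(gaugeModes L).starProjection (linkEmbed L v)‖ ≤ ‖linkEmbed L v‖ := Submodule.norm_starProjection_apply_le _ _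
        have hR0 : 0 ≤ R := (norm_nonneg _).trans hx
        exact div_le_div_of_nonneg_right (pow_le_pow_left₀ (norm_nonneg _) (hP.trans hx) 2) (sq_nonneg _)
      exact mul_le_mul h1 (Real.exp_le_exp.mpr h2) (Real.exp_pos _).le (sq_nonneg _)
  have hint : Integrable f (orthoTransverse L) := integrable_of_measurable_abs_le _ hfm hfb
  rw [integral_pos_iff_support_of_nonneg hf0 hint]
  refine lt_of_lt_of_le (orthoTransverse_ball_pos L hρ) (measure_mono fun v hv => ?_)
  have hne : Ω β (linkEmbed L v) ≠ 0 := hpos _ hv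
  rw [Function.mem_support, hf]; dsimp only
  exact mul_ne_zero (pow_ne_zero 2 hne) (Real.exp_pos _).ne'

/-! ## §3 The frozen profile of record -/

variable (L)

/-- **The frozen fibre profile** `Ω_β(x) = exp(−‖P_Γx‖²/(powScale 1 β)²)·exp(−q β x)·𝟙{‖x‖ ≤ r β}`: the gauge Gaussian matched to the record weight, an arbitrary colour-blind stiff
factor `e^{−q}`, and the support cut-off. [cite: Luscher1983, §3] -/
def frozenProfile (q : ℝ → LinkSpace L → ℝ) (r : ℝ → ℝ) (β : ℝ) (x : LinkSpace L) : ℝ :=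
  Real.exp (-(‖(gaugeModes L).starProjection x‖ ^ 2 / powScale 1 β ^ 2)) * Real.exp (-(q β x)) *
    (Metric.closedBall (0 : LinkSpace L) (r β)).indicator (fun _ => (1 : ℝ)) x

variable {L}

/-- The profile is measurable (for measurable `q β`). [folklore] -/
theorem measurable_frozenProfile {q : ℝ → LinkSpace L → ℝ} (hq : ∀ β, Measurable (q β)) (r : ℝ → ℝ) (β : ℝ) : Measurable (frozenProfile L q r β) := by
  unfold frozenProfile
  exact ((Real.measurable_exp.comp (((gaugeModes L).starProjection.continuous.measurable.norm.pow_const 2).div_const _).neg).mul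
    (Real.measurable_exp.comp (hq β).neg)).mul (measurable_const.indicator Metric.isClosed_closedBall.measurableSet)

/-- `0 ≤ Ω ≤ 1` (for `q β ≥ 0`). [folklore] -/
theorem frozenProfile_mem_Icc {q : ℝ → LinkSpace L → ℝ} (hq0 : ∀ β x, 0 ≤ q β x) (r : ℝ → ℝ) (β : ℝ) (x : LinkSpace L) :
    0 ≤ frozenProfile L q r β x ∧ frozenProfile L q r β x ≤ 1 := by
  unfold frozenProfile
  have h1 : Real.exp (-(‖(gaugeModes L).starProjection x‖ ^ 2 / powScale 1 β ^ 2)) ≤ 1 :=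
    Real.exp_le_one_iff.mpr (neg_nonpos.mpr (by positivity))
  have h2 : Real.exp (-(q β x)) ≤ 1 := Real.exp_le_one_iff.mpr (neg_nonpos.mpr (hq0 β x))
  have h3 : 0 ≤ (Metric.closedBall (0 : LinkSpace L) (r β)).indicator (fun _ => (1 : ℝ)) x ∧ (Metric.closedBall (0 : LinkSpace L) (r β)).indicator (fun _ => (1 : ℝ)) x ≤ 1 := by
    by_cases hx : x ∈ Metric.closedBall (0 : LinkSpace L) (r β)
    · rw [Set.indicator_of_mem hx]; exact ⟨zero_le_one, le_rfl⟩
    · rw [Set.indicator_of_notMem hx]; exact ⟨le_rfl, zero_le_one⟩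
  refine ⟨mul_nonneg (mul_nonneg (Real.exp_pos _).le (Real.exp_pos _).le) h3.1, ?_⟩
  calc _ ≤ 1 * 1 * 1 := mul_le_mul (mul_le_mul h1 h2 (Real.exp_pos _).le zero_le_one) h3.2 h3.1 (by norm_num)
    _ = 1 := by norm_num

/-- `|Ω| ≤ 1`. [folklore] -/
theorem abs_frozenProfile_le {q : ℝ → LinkSpace L → ℝ} (hq0 : ∀ β x, 0 ≤ q β x) (r : ℝ → ℝ) (β : ℝ) (x : LinkSpace L) : |frozenProfile L q r β x| ≤ 1 := by
  obtain ⟨h0, h1⟩ := frozenProfile_mem_Icc hq0 r β x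
  rw [abs_of_nonneg h0]; exact h1

/-- ★ **Colour blindness**: `Ω(Ad_g x) = Ω(x)` (for colour-blind `q β`; `P_Γ` commutes with `Ad_g`, which is an isometry). [folklore] -/
theorem frozenProfile_adL {q : ℝ → LinkSpace L → ℝ} (hqinv : ∀ β (g : SU2) (x : LinkSpace L), q β (adL L g x) = q β x) (r : ℝ → ℝ) (β : ℝ) (g : SU2)
    (x : LinkSpace L) : frozenProfile L q r β (adL L g x) = frozenProfile L q r β x := by
  unfold frozenProfile
  rw [starProjection_adL, LinearIsometryEquiv.norm_map, hqinv]
  have hball : (adL L g x ∈ Metric.closedBall (0 : LinkSpace L) (r β)) ↔ (x ∈ Metric.closedBall (0 : LinkSpace L) (r β)) := by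
    simp only [Metric.mem_closedBall, dist_zero_right, LinearIsometryEquiv.norm_map]
  by_cases hx : x ∈ Metric.closedBall (0 : LinkSpace L) (r β)
  · rw [Set.indicator_of_mem hx, Set.indicator_of_mem (hball.mpr hx)]
  · rw [Set.indicator_of_notMem hx, Set.indicator_of_notMem (fun h => hx (hball.mp h))]

/-- **Support**: `Ω x ≠ 0 → ‖x‖ ≤ r β`. [folklore] -/
theorem norm_le_of_frozenProfile_ne_zero (q : ℝ → LinkSpace L → ℝ) (r : ℝ → ℝ) (β : ℝ) {x : LinkSpace L} (hx : frozenProfile L q r β x ≠ 0) : ‖x‖ ≤ r β := by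
  by_contra h
  apply hx
  unfold frozenProfile
  rw [Set.indicator_of_notMem (by simpa [Metric.mem_closedBall, dist_zero_right] using h), mul_zero]

/-- **Non-vanishing on the open ball**: `‖x‖ < r β → Ω x ≠ 0`. [folklore] -/
theorem frozenProfile_ne_zero_of_norm_lt (q : ℝ → LinkSpace L → ℝ) (r : ℝ → ℝ) (β : ℝ) {x : LinkSpace L} (hx : ‖x‖ < r β) : frozenProfile L q r β x ≠ 0 := by
  unfold frozenProfile
  rw [Set.indicator_of_mem (by simpa [Metric.mem_closedBall, dist_zero_right] using hx.le), mul_one]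
  exact mul_ne_zero (Real.exp_pos _).ne' (Real.exp_pos _).ne'

/-- ★★ **THE FIVE STRUCTURAL FIELDS `hΩm hΩ1 hΩinv hΩr hγ` OF `RecordAnalyticInput` FOR THE FROZEN PROFILE** — for ANY measurable colour-blind stiff factor `q β ≥ 0` and ANY radii
`r β > 0`. [cite: Luscher1983, §3] -/
theorem frozenProfile_fields {q : ℝ → LinkSpace L → ℝ} (hq : ∀ β, Measurable (q β)) (hq0 : ∀ β x, 0 ≤ q β x)
    (hqinv : ∀ β (g : SU2) (x : LinkSpace L), q β (adL L g x) = q β x) {r : ℝ → ℝ} (hr : ∀ β, 0 < r β) :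
    (∀ β, Measurable (frozenProfile L q r β)) ∧ (∀ β x, |frozenProfile L q r β x| ≤ 1) ∧
      (∀ β (g : SU2) (x : LinkSpace L), frozenProfile L q r β (adL L g x) = frozenProfile L q r β x) ∧
      (∀ β x, frozenProfile L q r β x ≠ 0 → ‖x‖ ≤ r β) ∧ (∀ β, 0 < recordGamma L (frozenProfile L q r) β) :=
  ⟨fun β => measurable_frozenProfile hq r β, fun β x => abs_frozenProfile_le hq0 r β x, fun β g x => frozenProfile_adL hqinv r β g x,
    fun β _ hx => norm_le_of_frozenProfile_ne_zero q r β hx,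
    fun β => recordGamma_pos_of_ball (measurable_frozenProfile hq r β) (abs_frozenProfile_le hq0 r β) (fun _ hx => norm_le_of_frozenProfile_ne_zero q r β hx) (hr β)
      (fun _ hx => frozenProfile_ne_zero_of_norm_lt q r β hx)⟩

end Summit.QuantumFields.YangMills.Theorems.FemtoTransferGap.TwoLattice.ConstTube

end
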